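import Literature.MathematicalPhysics.QuantumLattice.HubbardRingExchangeSpinWaves

/-!
# Linear-spin-wave identities of the square-lattice BILAYER Heisenberg antiferromagnet (the producer behind «J⊥ = 11(2) meV from the ≈ 70 meV optical-magnon gap» of YBa₂Cu₃O₆₊ₓ)

Companion to `HubbardRingExchangeSpinWaves.lean` (single CuO₂ layer, `J–J′–J″–J_c`).  For the
antiferromagnetic CuO₂ BILAYER of YBa₂Cu₃O₆₊ₓ the inelastic-neutron data are fitted with the
Heisenberg Hamiltonian of a single bilayer [HaydenEtAl1996, Eq. (1)]
`H = J∥ Σ_{⟨ij⟩} Sᵢ·Sⱼ + J⊥ Σ_{⟨i j′⟩} Sᵢ·S′ⱼ`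
(nearest-neighbour intra-planar `J∥`, nearest-neighbour inter-planar `J⊥`), whose conventional
(Holstein–Primakoff) linear-spin-wave dispersion has two branches [HaydenEtAl1996, p. 4]
`ħω(Q) = 2J∥ [1 − γ²(Q) + (J⊥/2J∥)(1 ± γ(Q))]^{1/2}`, plus sign = ACOUSTIC (neighbouring spins in
the two planes precess together), minus sign = OPTICAL, `γ(Q) = ½(cos aQ_x + cos aQ_y)`; «the energy of
the optical branch shows a minimum at `Q = (½, ½, l)` of `ħω_g = 2√(J∥J⊥)`» [HaydenEtAl1996, p. 4],
«the optical mode gap is simply proportional to the geometric mean of `J∥` and `J⊥`, and so by itself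
its measurement establishes neither» [HaydenEtAl1996, p. 6]; printed fit for YBa₂Cu₃O₆.₁₅:
`ħω_g = 74 ± 5 meV`, `J∥ = 125 ± 5 meV`, `J⊥ = 11 ± 2 meV` [HaydenEtAl1996, pp. 5–6]; the review
value «intra-bilayer exchange 11(2) meV» from the «approximately 70 meV» gap [Tranquada2007, §8.3.2,
p. 16] quotes the same fits, next to `J = 106(7) meV` for YBa₂Cu₃O₆.₁ stated WITH the quantum
renormalisation `Z_c = 1.18` of the spin-wave velocity [Tranquada2007, Table 8.1].

Here the two branches are DEFINITIONS in the reciprocal-lattice-unit coordinates `(h, k)` of the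
companion file (`γ = (ν_h + ν_k)/2`, `ν_x = cos 2πx`), with an overall factor `Z_c` kept as a free
parameter exactly as there (`Z_c = 1` is Hayden's convention), and the theorems are the exact
statements the numbers above rest on:

* §2–§4: `γ` and both branches at the high-symmetry points — Goldstone zero of the acoustic branch and
  the optical GAP `2Z_c√(J∥J⊥)` at the antiferromagnetic zone centre `(½, ½)`; the two branches exchange
  roles at the nuclear zone centre `(0, 0)`; on the magnetic zone boundary (`(½, 0)`, `(¼, ¼)`) both
  equal `2Z_cJ∥√(1 + J⊥/2J∥) = Z_c√(4J∥² + 2J∥J⊥)`;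
* §5: at `J⊥ = 0` both branches ARE the single-layer dispersion `lswtOmega Z_c J 0 0 0` of the companion
  file (nearest-neighbour only);
* §6: the CONVENTION identity — `(Z_c, J∥, J⊥)` and `(1, Z_cJ∥, Z_cJ⊥)` give the same two branches and the
  same gap, so a fit identifies only the products `Z_cJ∥`, `Z_cJ⊥`; the ratio `J⊥/J∥` is convention-free
  (`125 meV` at `Z_c = 1` and `106 meV` at `Z_c = 1.18` are ONE datum: `125/1.18 ∈ (105.9, 106)`);
* §7: inversion of the gap, `J⊥ = ω_g²/(4Z_c²J∥)` (`bilayerJperpOfGap`), both round trips, strict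
  monotonicity, and the ERROR-BAR BRACKET: `ω_g ∈ [g₁, g₂]`, `J∥ ∈ [J₁, J₂]` ⇒
  `J⊥ ∈ [g₁²/(4Z_c²J₂), g₂²/(4Z_c²J₁)]` (independent bars propagated as a box, never averaged);
* §8: the printed numbers as instances — `2√(125·11) ∈ (74.1, 74.2)`; `ω_g ∈ [69, 79]`, `J∥ ∈ [120, 130]`,
  `Z_c = 1` ⇒ `J⊥ ∈ [4761/520, 6241/480] ⊂ (9.15, 13.01)` (= the printed `11 ± 2`); in the `Z_c = 1.18`
  convention of the `106 meV` entry the same gap gives `J⊥ ∈ (9.27, 9.28)` at `J∥ = 106`, i.e. the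
  review's pair (`106`, `11`) mixes the two conventions while `J⊥/J∥ = 0.088` does not; zone-boundary
  energy `250√(1 + 11/250) ∈ (255.4, 255.5)` meV (cf. «cut-off of approximately 250 meV for
  single-magnon scattering» [HaydenEtAl1996, p. 6]);
* §9: the leading-order superexchange dictionary `J = 4t²/U` [ColdeaEtAl2001, p. 3] applied bond by bond
  with one `U`: `J⊥/J∥ = (t⊥/t)²`, `U`-free — so `J⊥/J∥ = 11/125` reads `|t⊥/t| = √0.088 ∈ (0.296, 0.297)`
  at that order (a DERIVED one-band member, labelled so wherever used);
* §10: the bilayer as the `z = 1` case of ONE two-sublattice formula [Boothroyd2020, eq. (8.91)]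
  `ħω = (Z_c/2)√((4J + zJ⊥)² − (4Jγ + zJ⊥c)²)` for `z` antiparallel interlayer neighbours per spin with
  interlayer phase `c` — `z = 1`, `c = ±1` reproduce Hayden's two branches EXACTLY (proved), the stack
  gap is `2Z_c√(zJJ⊥)` for every `z` (bilayer `2√(JJ⊥)`, infinite layer `z = 2`: `2√2√(JJ⊥)`, the form
  printed for CaCuO₂ vs NdBa₂Cu₃O₇ [PengEtAl2017, p. 4]), its inversion `J⊥ = ω_g²/(4Z_c²zJ)` is the
  bilayer inversion divided by `z` (reading an infinite-layer gap with the bilayer formula DOUBLES `J⊥`),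
  and the printed fits as instances (`2√2√(158·4.3) ∈ (73.7, 73.8)`, `2√(123·6.2) ∈ (55.2, 55.3)` meV);
* §11: the same producer on the Pr bilayer — PrBa₂Cu₃O₆₊ₓ (x ≈ 0.2 and 0.93), where «We find
  `J∥ = 127 ± 10` meV and `J⊥ = 5.5 ± 0.9` meV. The value of `J∥` is virtually the same as that found in
  YBa₂Cu₃O₆.₂, but `J⊥` is a factor of two smaller. To within experimental error the values of `J∥` and
  `J⊥` … do not vary with oxygen doping» [BoothroydEtAl2005PrBCOSpinWaves, abstract and p. 5], from the
  acoustic dispersion (50–150 meV) and the zone-centre optic gap «53 ± 2 meV. The corresponding energy for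
  YBCO₆.₂ estimated in the same way … is 70 ± 5 meV» [ListerEtAl2001PrBCO, p. 2] (`54 ± 1` meV at
  x ≈ 0.93 [BoothroydEtAl2005PrBCOSpinWaves, p. 5]), with the dispersion of Eq. (2) there = the two
  branches of §1 at `Z_c = 1`: the fit is self-consistent (`2√(127·5.5) ∈ (52.8, 52.9)`), the printed
  `5.5 ± 0.9` IS the box image of `53 ± 2` and `127 ± 10` (`[51²/548, 55²/468] ⊂ (4.74, 6.47)`), the
  convention-free ratios (`J⊥/J∥ ∈ (0.0433, 0.0434)` vs YBCO's `0.088`; `J⊥(Pr)/J⊥(Y) = 0.5` within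
  `(0.423, 0.612)` over the printed YBCO₆.₁₅₋₆.₂ members `9–13` meV; same-criterion gap ratio
  `(53/70)² ∈ (0.573, 0.574)` = the `J⊥` ratio at equal `J∥`), the §9 leading-order hopping ratio
  `√(5.5/127) ∈ (0.208, 0.209)` (box `⊂ (0.183, 0.234)`) vs YBCO's `(0.296, 0.297)`, and the
  zone-boundary energy `√65913 ∈ (256.7, 256.8)` meV (above the measured range, «too low to obtain
  statistically meaningful data above 150 meV» [BoothroydEtAl2005PrBCOSpinWaves, p. 2]).

Not here: the Holstein–Primakoff derivation, the intensity/structure factors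
`sin²(½Δ_zQ_z)`, `cos²(½Δ_zQ_z)` and amplitude prefactors of [HaydenEtAl1996, Eqs. (2)–(3)], `1/S`
corrections inside `Z_c`, further-neighbour or ring terms in the bilayer (the companion file has them for
one layer), inter-bilayer coupling, or any claim that a measured dispersion obeys these formulas.

References: S. M. Hayden, G. Aeppli, T. G. Perring, H. A. Mook, F. Doğan, Phys. Rev. B 54 (1996)
R6905, arXiv:cond-mat/9605139, Eq. (1) and pp. 4–6; J. M. Tranquada, in *Handbook of High-Temperature
Superconductivity* (Springer, 2007), arXiv:cond-mat/0512115, §8.3.2 p. 16 and Table 8.1;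
R. Coldea et al., Phys. Rev. Lett. 86 (2001) 5377, p. 3; A. T. Boothroyd, *Principles of Neutron
Scattering from Condensed Matter* (OUP, 2020), §8.3.2 eqs. (8.88), (8.91); Y. Y. Peng et al., Nat. Phys.
13 (2017) 1201, arXiv:1609.05405, p. 4; A. T. Boothroyd, N. H. Andersen, B. H. Larsen,
A. A. Zhokhov, C. D. Frost, D. T. Adroja, Phys. Rev. B 71 (2005) 094514, arXiv:cond-mat/0502467,
abstract, Eq. (2), pp. 2, 4–5; S. J. S. Lister et al., Phys. Rev. Lett. 86 (2001) 5994,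
arXiv:cond-mat/0105292, pp. 2–3.
AI-produced formalisation (H21, cell hubbard-downfold, seat lit-2, 2026-08-27); no facts, no
axioms beyond Mathlib's, no `sorry`.
-/

namespace Literature.MathematicalPhysics.QuantumLattice

open Real

noncomputable section

/-! ## 1. The printed bilayer dispersion -/

/-- `γ(Q) = ½(cos aQ_x + cos aQ_y) = (ν_h + ν_k)/2` in reciprocal-lattice units `(h, k)`.
[cite: HaydenEtAl1996, p. 4] -/
def bilayerGamma (h k : ℝ) : ℝ := (lswtNu h + lswtNu k) / 2

/-- Radicand of the ACOUSTIC branch, `1 − γ² + (J⊥/2J∥)(1 + γ)`. [cite: HaydenEtAl1996, p. 4] -/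
def bilayerRadAc (J Jp h k : ℝ) : ℝ :=
  1 - bilayerGamma h k ^ 2 + Jp / (2 * J) * (1 + bilayerGamma h k)

/-- Radicand of the OPTICAL branch, `1 − γ² + (J⊥/2J∥)(1 − γ)`. [cite: HaydenEtAl1996, p. 4] -/
def bilayerRadOp (J Jp h k : ℝ) : ℝ :=
  1 - bilayerGamma h k ^ 2 + Jp / (2 * J) * (1 - bilayerGamma h k)

/-- Acoustic magnon energy `ħω_ac(Q) = 2Z_cJ∥ √(1 − γ² + (J⊥/2J∥)(1 + γ))` (`Z_c = 1` in the source;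
kept free as in the companion file). [cite: HaydenEtAl1996, p. 4] -/
def bilayerOmegaAc (Zc J Jp h k : ℝ) : ℝ := 2 * Zc * J * sqrt (bilayerRadAc J Jp h k)

/-- Optical magnon energy `ħω_op(Q) = 2Z_cJ∥ √(1 − γ² + (J⊥/2J∥)(1 − γ))`.
[cite: HaydenEtAl1996, p. 4] -/
def bilayerOmegaOp (Zc J Jp h k : ℝ) : ℝ := 2 * Zc * J * sqrt (bilayerRadOp J Jp h k)

/-- The optical-magnon gap `ħω_g = 2Z_c√(J∥J⊥)` («`2√(J∥J⊥)`» at `Z_c = 1`). [cite: HaydenEtAl1996, p. 4] -/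
def bilayerGap (Zc J Jp : ℝ) : ℝ := 2 * Zc * sqrt (J * Jp)

/-- The gap inverted for the inter-planar exchange at given intra-planar exchange:
`J⊥ = ω_g²/(4Z_c²J∥)`. [cite: HaydenEtAl1996, p. 6] -/
def bilayerJperpOfGap (Zc J g : ℝ) : ℝ := g ^ 2 / (4 * Zc ^ 2 * J)

/-- Unfolding. [cite: HaydenEtAl1996, p. 4] -/
theorem bilayerGamma_def (h k : ℝ) : bilayerGamma h k = (lswtNu h + lswtNu k) / 2 := rfl

/-- Unfolding. [cite: HaydenEtAl1996, p. 4] -/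
theorem bilayerRadAc_def (J Jp h k : ℝ) : bilayerRadAc J Jp h k =
    1 - bilayerGamma h k ^ 2 + Jp / (2 * J) * (1 + bilayerGamma h k) := rfl

/-- Unfolding. [cite: HaydenEtAl1996, p. 4] -/
theorem bilayerRadOp_def (J Jp h k : ℝ) : bilayerRadOp J Jp h k =
    1 - bilayerGamma h k ^ 2 + Jp / (2 * J) * (1 - bilayerGamma h k) := rfl

/-- Unfolding. [cite: HaydenEtAl1996, p. 4] -/
theorem bilayerOmegaAc_def (Zc J Jp h k : ℝ) :
    bilayerOmegaAc Zc J Jp h k = 2 * Zc * J * sqrt (bilayerRadAc J Jp h k) := rfl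

/-- Unfolding. [cite: HaydenEtAl1996, p. 4] -/
theorem bilayerOmegaOp_def (Zc J Jp h k : ℝ) :
    bilayerOmegaOp Zc J Jp h k = 2 * Zc * J * sqrt (bilayerRadOp J Jp h k) := rfl

/-- Unfolding. [cite: HaydenEtAl1996, p. 4] -/
theorem bilayerGap_def (Zc J Jp : ℝ) : bilayerGap Zc J Jp = 2 * Zc * sqrt (J * Jp) := rfl

/-- Unfolding. [cite: HaydenEtAl1996, p. 6] -/
theorem bilayerJperpOfGap_def (Zc J g : ℝ) : bilayerJperpOfGap Zc J g = g ^ 2 / (4 * Zc ^ 2 * J) := rfl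

/-! ## 2. `γ` at the high-symmetry points, symmetry and range -/

/-- `γ(0, 0) = 1` (nuclear zone centre). [cite: HaydenEtAl1996, p. 4] -/
theorem bilayerGamma_zero_zero : bilayerGamma 0 0 = 1 := by
  rw [bilayerGamma, lswtNu_zero]; norm_num

/-- `γ(½, ½) = −1` (antiferromagnetic zone centre `(π, π)`). [cite: HaydenEtAl1996, p. 4] -/
theorem bilayerGamma_half_half : bilayerGamma (1 / 2) (1 / 2) = -1 := by
  rw [bilayerGamma, lswtNu_half]; norm_num

/-- `γ(½, 0) = 0` (zone boundary `(π, 0)`). [cite: HaydenEtAl1996, p. 4] -/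
theorem bilayerGamma_half_zero : bilayerGamma (1 / 2) 0 = 0 := by
  rw [bilayerGamma, lswtNu_half, lswtNu_zero]; norm_num

/-- `γ(0, ½) = 0`. [cite: HaydenEtAl1996, p. 4] -/
theorem bilayerGamma_zero_half : bilayerGamma 0 (1 / 2) = 0 := by
  rw [bilayerGamma, lswtNu_half, lswtNu_zero]; norm_num

/-- `γ(¼, ¼) = 0` (zone boundary `(π/2, π/2)`). [cite: HaydenEtAl1996, p. 4] -/
theorem bilayerGamma_quarter_quarter : bilayerGamma (1 / 4) (1 / 4) = 0 := by
  rw [bilayerGamma, lswtNu_quarter]; norm_num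

/-- `γ` is symmetric under `h ↔ k`. [cite: HaydenEtAl1996, p. 4] -/
theorem bilayerGamma_comm (h k : ℝ) : bilayerGamma h k = bilayerGamma k h := by
  rw [bilayerGamma, bilayerGamma, add_comm]

/-- `−1 ≤ γ ≤ 1`. [cite: HaydenEtAl1996, p. 4] -/
theorem bilayerGamma_mem_Icc (h k : ℝ) : bilayerGamma h k ∈ Set.Icc (-1 : ℝ) 1 := by
  have h1 := neg_one_le_cos (2 * π * h)
  have h2 := cos_le_one (2 * π * h)
  have h3 := neg_one_le_cos (2 * π * k)
  have h4 := cos_le_one (2 * π * k)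
  simp only [bilayerGamma, lswtNu, Set.mem_Icc]
  constructor <;> linarith

/-- Both radicands are non-negative for `J∥ > 0`, `J⊥ ≥ 0` (so Lean's `√` is the real square root
there). [cite: HaydenEtAl1996, p. 4] -/
theorem bilayerRad_nonneg {J Jp : ℝ} (hJ : 0 < J) (hJp : 0 ≤ Jp) (h k : ℝ) :
    0 ≤ bilayerRadAc J Jp h k ∧ 0 ≤ bilayerRadOp J Jp h k := by
  obtain ⟨hlo, hhi⟩ := bilayerGamma_mem_Icc h k
  have hr : 0 ≤ Jp / (2 * J) := div_nonneg hJp (by linarith)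
  have hsq : bilayerGamma h k ^ 2 ≤ 1 := by nlinarith
  refine ⟨?_, ?_⟩
  · rw [bilayerRadAc]
    have : 0 ≤ Jp / (2 * J) * (1 + bilayerGamma h k) := mul_nonneg hr (by linarith)
    linarith
  · rw [bilayerRadOp]
    have : 0 ≤ Jp / (2 * J) * (1 - bilayerGamma h k) := mul_nonneg hr (by linarith)
    linarith

/-! ## 3. Zone centres: Goldstone zero, the optical gap, and the role exchange -/

/-- At the antiferromagnetic zone centre `(½, ½)` the acoustic radicand vanishes.
[cite: HaydenEtAl1996, p. 4] -/
theorem bilayerRadAc_half_half (J Jp : ℝ) : bilayerRadAc J Jp (1 / 2) (1 / 2) = 0 := by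
  rw [bilayerRadAc, bilayerGamma_half_half]; ring

/-- At `(½, ½)` the optical radicand is `J⊥/J∥`. [cite: HaydenEtAl1996, p. 4] -/
theorem bilayerRadOp_half_half (J Jp : ℝ) : bilayerRadOp J Jp (1 / 2) (1 / 2) = Jp / J := by
  rw [bilayerRadOp, bilayerGamma_half_half]; ring

/-- **Goldstone mode**: `ħω_ac(½, ½) = 0`. [cite: HaydenEtAl1996, p. 4] -/
theorem bilayerOmegaAc_half_half (Zc J Jp : ℝ) : bilayerOmegaAc Zc J Jp (1 / 2) (1 / 2) = 0 := by
  rw [bilayerOmegaAc, bilayerRadAc_half_half, sqrt_zero, mul_zero]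

/-- Plumbing: `J·√(J⊥/J) = √(J·J⊥)` for `J > 0`. [folklore] -/
private lemma mul_sqrt_div_self {J Jp : ℝ} (hJ : 0 < J) : J * sqrt (Jp / J) = sqrt (J * Jp) := by
  have h : J ^ 2 * (Jp / J) = J * Jp := by
    field_simp
  rw [← h, sqrt_mul (sq_nonneg J), sqrt_sq hJ.le]

/-- **The optical gap**: `ħω_op(½, ½) = 2Z_cJ∥√(J⊥/J∥) = 2Z_c√(J∥J⊥) = ω_g` (`J∥ > 0`).
[cite: HaydenEtAl1996, p. 4] -/
theorem bilayerOmegaOp_half_half {J : ℝ} (Zc Jp : ℝ) (hJ : 0 < J) :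
    bilayerOmegaOp Zc J Jp (1 / 2) (1 / 2) = bilayerGap Zc J Jp := by
  rw [bilayerOmegaOp, bilayerRadOp_half_half, bilayerGap, mul_assoc, mul_sqrt_div_self hJ]

/-- At the nuclear zone centre `(0, 0)` the optical radicand vanishes. [cite: HaydenEtAl1996, p. 4] -/
theorem bilayerRadOp_zero_zero (J Jp : ℝ) : bilayerRadOp J Jp 0 0 = 0 := by
  rw [bilayerRadOp, bilayerGamma_zero_zero]; ring

/-- At `(0, 0)` the acoustic radicand is `J⊥/J∥`. [cite: HaydenEtAl1996, p. 4] -/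
theorem bilayerRadAc_zero_zero (J Jp : ℝ) : bilayerRadAc J Jp 0 0 = Jp / J := by
  rw [bilayerRadAc, bilayerGamma_zero_zero]; ring

/-- Role exchange at `(0, 0)`: the OPTICAL branch is gapless there … [cite: HaydenEtAl1996, p. 4] -/
theorem bilayerOmegaOp_zero_zero (Zc J Jp : ℝ) : bilayerOmegaOp Zc J Jp 0 0 = 0 := by
  rw [bilayerOmegaOp, bilayerRadOp_zero_zero, sqrt_zero, mul_zero]

/-- … and the ACOUSTIC branch sits at the gap energy `2Z_c√(J∥J⊥)` (`J∥ > 0`).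
[cite: HaydenEtAl1996, p. 4] -/
theorem bilayerOmegaAc_zero_zero {J : ℝ} (Zc Jp : ℝ) (hJ : 0 < J) :
    bilayerOmegaAc Zc J Jp 0 0 = bilayerGap Zc J Jp := by
  rw [bilayerOmegaAc, bilayerRadAc_zero_zero, bilayerGap, mul_assoc, mul_sqrt_div_self hJ]

/-! ## 4. The magnetic zone boundary: both branches at `2Z_cJ∥√(1 + J⊥/2J∥)` -/

/-- At `(½, 0)` both radicands equal `1 + J⊥/2J∥`. [cite: HaydenEtAl1996, p. 4] -/
theorem bilayerRad_half_zero (J Jp : ℝ) :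
    bilayerRadAc J Jp (1 / 2) 0 = 1 + Jp / (2 * J) ∧ bilayerRadOp J Jp (1 / 2) 0 = 1 + Jp / (2 * J) := by
  rw [bilayerRadAc, bilayerRadOp, bilayerGamma_half_zero]; constructor <;> ring

/-- At `(¼, ¼)` both radicands equal `1 + J⊥/2J∥`. [cite: HaydenEtAl1996, p. 4] -/
theorem bilayerRad_quarter_quarter (J Jp : ℝ) :
    bilayerRadAc J Jp (1 / 4) (1 / 4) = 1 + Jp / (2 * J) ∧
      bilayerRadOp J Jp (1 / 4) (1 / 4) = 1 + Jp / (2 * J) := by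
  rw [bilayerRadAc, bilayerRadOp, bilayerGamma_quarter_quarter]; constructor <;> ring

/-- Zone-boundary energy at `(½, 0)`: acoustic = optical = `2Z_cJ∥√(1 + J⊥/2J∥)` (no zone-boundary
dispersion and no acoustic/optical splitting at this order). [cite: HaydenEtAl1996, p. 4] -/
theorem bilayerOmega_half_zero (Zc J Jp : ℝ) :
    bilayerOmegaAc Zc J Jp (1 / 2) 0 = 2 * Zc * J * sqrt (1 + Jp / (2 * J)) ∧
      bilayerOmegaOp Zc J Jp (1 / 2) 0 = 2 * Zc * J * sqrt (1 + Jp / (2 * J)) := by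
  obtain ⟨ha, ho⟩ := bilayerRad_half_zero J Jp
  exact ⟨by rw [bilayerOmegaAc, ha], by rw [bilayerOmegaOp, ho]⟩

/-- Zone-boundary energy at `(¼, ¼)`: the same value as at `(½, 0)`. [cite: HaydenEtAl1996, p. 4] -/
theorem bilayerOmega_quarter_quarter (Zc J Jp : ℝ) :
    bilayerOmegaAc Zc J Jp (1 / 4) (1 / 4) = 2 * Zc * J * sqrt (1 + Jp / (2 * J)) ∧
      bilayerOmegaOp Zc J Jp (1 / 4) (1 / 4) = 2 * Zc * J * sqrt (1 + Jp / (2 * J)) := by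
  obtain ⟨ha, ho⟩ := bilayerRad_quarter_quarter J Jp
  exact ⟨by rw [bilayerOmegaAc, ha], by rw [bilayerOmegaOp, ho]⟩

/-- The zone-boundary energy in closed form, `2Z_cJ∥√(1 + J⊥/2J∥) = Z_c√(4J∥² + 2J∥J⊥)`
(`J∥ > 0`). [cite: HaydenEtAl1996, p. 4] -/
theorem bilayerOmega_zoneBoundary_closed {J : ℝ} (Zc Jp : ℝ) (hJ : 0 < J) :
    2 * Zc * J * sqrt (1 + Jp / (2 * J)) = Zc * sqrt (4 * J ^ 2 + 2 * J * Jp) := by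
  have h : (2 * J) ^ 2 * (1 + Jp / (2 * J)) = 4 * J ^ 2 + 2 * J * Jp := by
    field_simp
    ring
  rw [← h, sqrt_mul (sq_nonneg (2 * J)), sqrt_sq (by linarith)]
  ring

/-! ## 5. `J⊥ = 0`: both branches are the single-layer nearest-neighbour dispersion of the companion file -/

/-- With `J′ = J″ = J_c = 0` the companion file's `A_Q = J`. [cite: ColdeaEtAl2001, p. 3] -/
theorem lswtA_nn (J h k : ℝ) : lswtA J 0 0 0 h k = J := by
  rw [lswtA]; ring

/-- With `J_c = 0` the companion file's `B_Q = Jγ(Q)`. [cite: ColdeaEtAl2001, p. 3] -/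
theorem lswtB_nn (J h k : ℝ) : lswtB J 0 h k = J * bilayerGamma h k := by
  rw [lswtB, bilayerGamma]; ring

/-- At `J⊥ = 0` both bilayer radicands are `1 − γ²`. [cite: HaydenEtAl1996, p. 4] -/
theorem bilayerRad_of_jperp_zero (J h k : ℝ) :
    bilayerRadAc J 0 h k = 1 - bilayerGamma h k ^ 2 ∧ bilayerRadOp J 0 h k = 1 - bilayerGamma h k ^ 2 := by
  rw [bilayerRadAc, bilayerRadOp]; constructor <;> simp

/-- **Single-layer reduction**: at `J⊥ = 0` the acoustic branch equals the nearest-neighbour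
square-lattice dispersion `lswtOmega Z_c J 0 0 0 = 2Z_c√(J² − J²γ²)` of the companion file (`J ≥ 0`).
[cite: HaydenEtAl1996, p. 4] -/
theorem bilayerOmegaAc_of_jperp_zero {J : ℝ} (Zc h k : ℝ) (hJ : 0 ≤ J) :
    bilayerOmegaAc Zc J 0 h k = lswtOmega Zc J 0 0 0 h k := by
  rw [bilayerOmegaAc, (bilayerRad_of_jperp_zero J h k).1, lswtOmega, lswtA_nn, lswtB_nn]
  have : J ^ 2 - (J * bilayerGamma h k) ^ 2 = J ^ 2 * (1 - bilayerGamma h k ^ 2) := by ring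
  rw [this, sqrt_mul (sq_nonneg J), sqrt_sq hJ]
  ring

/-- The same for the optical branch. [cite: HaydenEtAl1996, p. 4] -/
theorem bilayerOmegaOp_of_jperp_zero {J : ℝ} (Zc h k : ℝ) (hJ : 0 ≤ J) :
    bilayerOmegaOp Zc J 0 h k = lswtOmega Zc J 0 0 0 h k := by
  rw [bilayerOmegaOp, (bilayerRad_of_jperp_zero J h k).2, lswtOmega, lswtA_nn, lswtB_nn]
  have : J ^ 2 - (J * bilayerGamma h k) ^ 2 = J ^ 2 * (1 - bilayerGamma h k ^ 2) := by ring
  rw [this, sqrt_mul (sq_nonneg J), sqrt_sq hJ]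
  ring

/-! ## 6. The convention identity: only `Z_cJ∥` and `Z_cJ⊥` are identified; `J⊥/J∥` is convention-free -/

/-- The radicands depend on the couplings only through `J⊥/J∥`: common rescaling leaves them fixed
(`c ≠ 0`). [cite: HaydenEtAl1996, p. 6] -/
theorem bilayerRad_scale {c : ℝ} (J Jp h k : ℝ) (hc : c ≠ 0) :
    bilayerRadAc (c * J) (c * Jp) h k = bilayerRadAc J Jp h k ∧
      bilayerRadOp (c * J) (c * Jp) h k = bilayerRadOp J Jp h k := by
  have : c * Jp / (2 * (c * J)) = Jp / (2 * J) := by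
    rw [show 2 * (c * J) = c * (2 * J) by ring]
    exact mul_div_mul_left Jp (2 * J) hc
  rw [bilayerRadAc, bilayerRadAc, bilayerRadOp, bilayerRadOp, this]
  exact ⟨rfl, rfl⟩

/-- **Convention identity (acoustic)**: `ω_ac(Z_c; J∥, J⊥) = ω_ac(1; Z_cJ∥, Z_cJ⊥)` (`Z_c ≠ 0`) — a
renormalisation factor on the energy scale is indistinguishable from rescaled exchange constants.
[cite: Tranquada2007, Table 8.1] -/
theorem bilayerOmegaAc_convention {Zc : ℝ} (J Jp h k : ℝ) (hZ : Zc ≠ 0) :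
    bilayerOmegaAc Zc J Jp h k = bilayerOmegaAc 1 (Zc * J) (Zc * Jp) h k := by
  rw [bilayerOmegaAc, bilayerOmegaAc, (bilayerRad_scale J Jp h k hZ).1]; ring

/-- **Convention identity (optical)**: `ω_op(Z_c; J∥, J⊥) = ω_op(1; Z_cJ∥, Z_cJ⊥)` (`Z_c ≠ 0`).
[cite: Tranquada2007, Table 8.1] -/
theorem bilayerOmegaOp_convention {Zc : ℝ} (J Jp h k : ℝ) (hZ : Zc ≠ 0) :
    bilayerOmegaOp Zc J Jp h k = bilayerOmegaOp 1 (Zc * J) (Zc * Jp) h k := by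
  rw [bilayerOmegaOp, bilayerOmegaOp, (bilayerRad_scale J Jp h k hZ).2]; ring

/-- **Convention identity (gap)**: `ω_g(Z_c; J∥, J⊥) = ω_g(1; Z_cJ∥, Z_cJ⊥)` (`Z_c ≥ 0`).
[cite: Tranquada2007, Table 8.1] -/
theorem bilayerGap_convention {Zc : ℝ} (J Jp : ℝ) (hZ : 0 ≤ Zc) :
    bilayerGap Zc J Jp = bilayerGap 1 (Zc * J) (Zc * Jp) := by
  rw [bilayerGap, bilayerGap]
  have : Zc * J * (Zc * Jp) = Zc ^ 2 * (J * Jp) := by ring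
  rw [this, sqrt_mul (sq_nonneg Zc), sqrt_sq hZ]
  ring

/-- The ratio `J⊥/J∥` is the same in every convention (`Z_c ≠ 0`). [cite: HaydenEtAl1996, p. 6] -/
theorem jperp_ratio_convention {Zc : ℝ} (J Jp : ℝ) (hZ : Zc ≠ 0) : Zc * Jp / (Zc * J) = Jp / J :=
  mul_div_mul_left Jp J hZ

/-- The `Z_c = 1` value `J∥ = 125 meV` [HaydenEtAl1996] and the `Z_c = 1.18` value `J = 106(7) meV`
[Tranquada2007, Table 8.1] are one datum: `125/1.18 ∈ (105.9, 106)`. [cite: Tranquada2007, Table 8.1] -/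
theorem hayden_J_in_tranquada_convention :
    (105.9 : ℝ) < 125 / (59 / 50) ∧ (125 : ℝ) / (59 / 50) < 106 := by
  constructor <;> norm_num

/-- … and Hayden's `J⊥ = 11 meV` in the `Z_c = 1.18` convention is `11/1.18 ∈ (9.32, 9.33)` meV, NOT
the «11(2)» printed next to `106(7)` in the review. [cite: Tranquada2007, §8.3.2 p. 16] -/
theorem hayden_Jperp_in_tranquada_convention :
    (9.32 : ℝ) < 11 / (59 / 50) ∧ (11 : ℝ) / (59 / 50) < 9.33 := by
  constructor <;> norm_num

/-! ## 7. Inverting the gap for `J⊥`; monotonicity; the error-bar bracket -/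

/-- `ω_g² = 4Z_c²J∥J⊥` (`J∥J⊥ ≥ 0`). [cite: HaydenEtAl1996, p. 4] -/
theorem bilayerGap_sq {J Jp : ℝ} (Zc : ℝ) (h : 0 ≤ J * Jp) :
    bilayerGap Zc J Jp ^ 2 = 4 * Zc ^ 2 * (J * Jp) := by
  rw [bilayerGap, mul_pow, mul_pow, sq_sqrt h]; ring

/-- `ω_g ≥ 0` for `Z_c ≥ 0`. [cite: HaydenEtAl1996, p. 4] -/
theorem bilayerGap_nonneg {Zc : ℝ} (J Jp : ℝ) (hZ : 0 ≤ Zc) : 0 ≤ bilayerGap Zc J Jp := by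
  rw [bilayerGap]; positivity

/-- Round trip 1: the gap of `(J∥, J⊥)` inverted at `J∥` returns `J⊥` (`Z_c ≠ 0`, `J∥ > 0`, `J⊥ ≥ 0`).
[cite: HaydenEtAl1996, p. 6] -/
theorem bilayerJperpOfGap_gap {Zc J Jp : ℝ} (hZ : Zc ≠ 0) (hJ : 0 < J) (hJp : 0 ≤ Jp) :
    bilayerJperpOfGap Zc J (bilayerGap Zc J Jp) = Jp := by
  rw [bilayerJperpOfGap, bilayerGap_sq Zc (mul_nonneg hJ.le hJp)]
  field_simp

/-- Round trip 2: the model with `J⊥ = ω_g²/(4Z_c²J∥)` has optical gap `ω_g` (`Z_c > 0`, `J∥ > 0`,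
`ω_g ≥ 0`). [cite: HaydenEtAl1996, p. 6] -/
theorem bilayerGap_jperpOfGap {Zc J g : ℝ} (hZ : 0 < Zc) (hJ : 0 < J) (hg : 0 ≤ g) :
    bilayerGap Zc J (bilayerJperpOfGap Zc J g) = g := by
  rw [bilayerGap, bilayerJperpOfGap]
  have : J * (g ^ 2 / (4 * Zc ^ 2 * J)) = (g / (2 * Zc)) ^ 2 := by
    field_simp
    ring
  rw [this, sqrt_sq (div_nonneg hg (by linarith))]
  field_simp

/-- So `(½, ½)` carries optical energy exactly `ω_g` in that model. [cite: HaydenEtAl1996, p. 4] -/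
theorem bilayerOmegaOp_half_half_jperpOfGap {Zc J g : ℝ} (hZ : 0 < Zc) (hJ : 0 < J) (hg : 0 ≤ g) :
    bilayerOmegaOp Zc J (bilayerJperpOfGap Zc J g) (1 / 2) (1 / 2) = g := by
  rw [bilayerOmegaOp_half_half Zc _ hJ, bilayerGap_jperpOfGap hZ hJ hg]

/-- The gap is strictly increasing in `J⊥` on `[0, ∞)` (`Z_c > 0`, `J∥ > 0`): a measured gap and a
known `J∥` determine `J⊥` uniquely. [cite: HaydenEtAl1996, p. 6] -/
theorem bilayerGap_strictMonoOn {Zc J : ℝ} (hZ : 0 < Zc) (hJ : 0 < J) :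
    StrictMonoOn (fun Jp => bilayerGap Zc J Jp) (Set.Ici 0) := by
  intro a ha b _ hab
  simp only [bilayerGap]
  have ha' : 0 ≤ J * a := mul_nonneg hJ.le ha
  have hlt : J * a < J * b := mul_lt_mul_of_pos_left hab hJ
  have := sqrt_lt_sqrt ha' hlt
  nlinarith

/-- Hence the gap is injective in `J⊥ ≥ 0`. [cite: HaydenEtAl1996, p. 6] -/
theorem bilayerGap_injOn {Zc J : ℝ} (hZ : 0 < Zc) (hJ : 0 < J) :
    Set.InjOn (fun Jp => bilayerGap Zc J Jp) (Set.Ici 0) :=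
  (bilayerGap_strictMonoOn hZ hJ).injOn

/-- `J⊥(ω_g)` is monotone in the gap on `ω_g ≥ 0` (`J∥ > 0`). [cite: HaydenEtAl1996, p. 6] -/
theorem bilayerJperpOfGap_mono_gap {Zc J g₁ g₂ : ℝ} (hJ : 0 < J) (hg₁ : 0 ≤ g₁) (h : g₁ ≤ g₂) :
    bilayerJperpOfGap Zc J g₁ ≤ bilayerJperpOfGap Zc J g₂ := by
  rw [bilayerJperpOfGap, bilayerJperpOfGap]
  have hsq : g₁ ^ 2 ≤ g₂ ^ 2 := by nlinarith
  have hden : 0 ≤ 4 * Zc ^ 2 * J := by positivity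
  exact div_le_div_of_nonneg_right hsq hden

/-- `J⊥(ω_g)` is antitone in `J∥` on `J∥ > 0` (`Z_c ≠ 0`). [cite: HaydenEtAl1996, p. 6] -/
theorem bilayerJperpOfGap_anti_J {Zc J₁ J₂ : ℝ} (g : ℝ) (hZ : Zc ≠ 0) (hJ₁ : 0 < J₁) (h : J₁ ≤ J₂) :
    bilayerJperpOfGap Zc J₂ g ≤ bilayerJperpOfGap Zc J₁ g := by
  rw [bilayerJperpOfGap, bilayerJperpOfGap]
  have hZ2 : 0 < Zc ^ 2 := by positivity
  have hnum : 0 ≤ g ^ 2 := sq_nonneg g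
  have hd₁ : 0 < 4 * Zc ^ 2 * J₁ := by positivity
  have hd : 4 * Zc ^ 2 * J₁ ≤ 4 * Zc ^ 2 * J₂ := by nlinarith
  exact div_le_div_of_nonneg_left hnum hd₁ hd

/-- **Error-bar bracket** (independent bars on the gap and on `J∥` propagated as a box through the
monotone map; never an average): `ω_g ∈ [g₁, g₂]`, `J∥ ∈ [J₁, J₂]` with `0 ≤ g₁`, `0 < J₁`, `Z_c ≠ 0` ⇒
`g₁²/(4Z_c²J₂) ≤ J⊥ ≤ g₂²/(4Z_c²J₁)`. [cite: HaydenEtAl1996, p. 6] -/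
theorem bilayerJperpOfGap_box {Zc J J₁ J₂ g g₁ g₂ : ℝ} (hZ : Zc ≠ 0) (hJ₁ : 0 < J₁) (hJlo : J₁ ≤ J)
    (hJhi : J ≤ J₂) (hg₁ : 0 ≤ g₁) (hglo : g₁ ≤ g) (hghi : g ≤ g₂) :
    bilayerJperpOfGap Zc J₂ g₁ ≤ bilayerJperpOfGap Zc J g ∧
      bilayerJperpOfGap Zc J g ≤ bilayerJperpOfGap Zc J₁ g₂ := by
  have hJ : 0 < J := lt_of_lt_of_le hJ₁ hJlo
  constructor
  · exact (bilayerJperpOfGap_anti_J g₁ hZ hJ hJhi).trans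
      (bilayerJperpOfGap_mono_gap hJ hg₁ hglo)
  · exact (bilayerJperpOfGap_mono_gap hJ (hg₁.trans hglo) hghi).trans
      (bilayerJperpOfGap_anti_J g₂ hZ hJ₁ hJlo)

/-! ## 8. The printed numbers (YBa₂Cu₃O₆.₁₅, meV) -/

/-- Hayden's fit is self-consistent: `(2√(125·11))² = 5500`, i.e. `ω_g = √5500 ∈ (74.1, 74.2)` vs the
printed `74 ± 5`. [cite: HaydenEtAl1996, pp. 5–6] -/
theorem hayden1996_gap : bilayerGap 1 125 11 ^ 2 = 5500 ∧
    (74.1 : ℝ) < bilayerGap 1 125 11 ∧ bilayerGap 1 125 11 < 74.2 := by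
  have hsq : bilayerGap 1 125 11 ^ 2 = 5500 := by
    rw [bilayerGap_sq 1 (by norm_num)]; norm_num
  have hnn : 0 ≤ bilayerGap 1 125 11 := bilayerGap_nonneg 125 11 zero_le_one
  refine ⟨hsq, ?_, ?_⟩
  · nlinarith
  · nlinarith

/-- The inverse map at the central values: `74²/(4·125) = 5476/500 = 10.952`.
[cite: HaydenEtAl1996, pp. 5–6] -/
theorem hayden1996_jperp_central : bilayerJperpOfGap 1 125 74 = 10.952 := by
  rw [bilayerJperpOfGap]; norm_num

/-- **The printed `J⊥ = 11 ± 2` is the box image of `ω_g = 74 ± 5`, `J∥ = 125 ± 5`**: every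
`(ω_g, J∥)` in `[69, 79] × [120, 130]` gives `J⊥ ∈ [69²/(4·130), 79²/(4·120)] = [4761/520, 6241/480]`.
[cite: HaydenEtAl1996, pp. 5–6] -/
theorem hayden1996_jperp_box {g J : ℝ} (hg : g ∈ Set.Icc (69 : ℝ) 79) (hJ : J ∈ Set.Icc (120 : ℝ) 130) :
    (4761 : ℝ) / 520 ≤ bilayerJperpOfGap 1 J g ∧ bilayerJperpOfGap 1 J g ≤ 6241 / 480 := by
  obtain ⟨hglo, hghi⟩ := hg
  obtain ⟨hJlo, hJhi⟩ := hJ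
  obtain ⟨h1, h2⟩ := bilayerJperpOfGap_box (Zc := 1) one_ne_zero (by norm_num : (0 : ℝ) < 120) hJlo hJhi
    (by norm_num : (0 : ℝ) ≤ 69) hglo hghi
  refine ⟨le_trans (le_of_eq ?_) h1, le_trans h2 (le_of_eq ?_)⟩
  · rw [bilayerJperpOfGap]; norm_num
  · rw [bilayerJperpOfGap]; norm_num

/-- … and that box is `⊂ (9.15, 13.01)` meV — the printed `11 ± 2`. [cite: HaydenEtAl1996, p. 6] -/
theorem hayden1996_jperp_box_decimal : (9.15 : ℝ) < 4761 / 520 ∧ (6241 : ℝ) / 480 < 13.01 := by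
  constructor <;> norm_num

/-- In the `Z_c = 1.18` convention of the review's `J = 106 meV` entry the same `74 meV` gap gives
`J⊥ = 74²/(4·1.18²·106) ∈ (9.27, 9.28)` meV: the review's pair (`106(7)`, `11(2)`) mixes conventions.
[cite: Tranquada2007, Table 8.1] -/
theorem tranquada_convention_jperp :
    (9.27 : ℝ) < bilayerJperpOfGap (59 / 50) 106 74 ∧ bilayerJperpOfGap (59 / 50) 106 74 < 9.28 := by
  rw [bilayerJperpOfGap]; constructor <;> norm_num

/-- The convention-free ratio: `J⊥/J∥ = 11/125 = 0.088`. [cite: HaydenEtAl1996, p. 6] -/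
theorem hayden1996_ratio : (11 : ℝ) / 125 = 0.088 := by norm_num

/-- Zone-boundary (single-magnon cut-off) energy at Hayden's values, `Z_c = 1`:
`ω(½, 0) = 250√(1 + 11/250) = √65250 ∈ (255.4, 255.5)` meV (cf. «cut-off of approximately 250 meV»).
[cite: HaydenEtAl1996, p. 6] -/
theorem hayden1996_zoneBoundary :
    bilayerOmegaAc 1 125 11 (1 / 2) 0 ^ 2 = 65250 ∧
      (255.4 : ℝ) < bilayerOmegaAc 1 125 11 (1 / 2) 0 ∧ bilayerOmegaAc 1 125 11 (1 / 2) 0 < 255.5 := by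
  have hval : bilayerOmegaAc 1 125 11 (1 / 2) 0 = sqrt 65250 := by
    rw [(bilayerOmega_half_zero 1 125 11).1,
      bilayerOmega_zoneBoundary_closed 1 11 (by norm_num : (0 : ℝ) < 125)]
    norm_num
  have hnn : (0 : ℝ) ≤ 65250 := by norm_num
  rw [hval, sq_sqrt hnn]
  refine ⟨rfl, ?_, ?_⟩
  · rw [lt_sqrt (by norm_num)]; norm_num
  · rw [sqrt_lt' (by norm_num)]; norm_num

/-! ## 9. Leading-order superexchange dictionary, bond by bond: `J⊥/J∥ = (t⊥/t)²` -/

/-- With the leading-order superexchange `J = 4t²/U` [ColdeaEtAl2001, p. 3] on the in-plane bond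
(`t`) and on the inter-planar bond (`t⊥`) with ONE `U`, the ratio is `U`-free:
`(4t⊥²/U)/(4t²/U) = (t⊥/t)²` (`U ≠ 0`, `t ≠ 0`). [cite: ColdeaEtAl2001, p. 3] -/
theorem superexchangeRatio_eq_hoppingRatio_sq {t tp U : ℝ} (hU : U ≠ 0) (ht : t ≠ 0) :
    4 * tp ^ 2 / U / (4 * t ^ 2 / U) = (tp / t) ^ 2 := by
  field_simp

/-- So at that order `|t⊥/t| = √(J⊥/J∥)`; for `J⊥/J∥ = 11/125`: `√0.088 ∈ (0.296, 0.297)` (a DERIVED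
one-band member). [cite: ColdeaEtAl2001, p. 3] -/
theorem hayden1996_hoppingRatio :
    (0.296 : ℝ) < sqrt (11 / 125) ∧ sqrt ((11 : ℝ) / 125) < 0.297 := by
  constructor
  · rw [lt_sqrt (by norm_num)]; norm_num
  · rw [sqrt_lt' (by norm_num)]; norm_num


/-! ## 10. Stacks: `z` antiparallel interlayer neighbours per spin — the bilayer (`z = 1`) and the
infinite-layer stack (`z = 2`) in ONE two-sublattice formula

Two-sublattice linear spin-wave theory gives `ħω(Q) = S√(J(0)² − J(Q)²)` with `J(Q)` the Fourier sum of
the exchange to the ANTIPARALLEL neighbours [Boothroyd2020, eq. (8.91); square lattice: `J(Q) =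
2J{cos Q·a + cos Q·b}`, `J(0) = 4J`, eq. (8.88)].  For a square-lattice layer (exchange `J`, in-plane
phase `γ(h, k)`) each of whose spins has in addition `z` antiparallel INTERLAYER neighbours (exchange
`J⊥`) entering with a common interlayer phase `c`, `J(0) = 4J + zJ⊥` and `J(Q) = 4Jγ + zJ⊥c`; at
`S = ½` and with the overall factor `Z_c` of this file, `ħω = (Z_c/2)√((4J + zJ⊥)² − (4Jγ + zJ⊥c)²)`.
`z = 1`, `c = ±1` ARE Hayden's two bilayer branches (proved below, not assumed); `z = 2`, `c = cos 2πL`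
is the infinite-layer stack, for which «the model … gives `E(0,0,½) ≃ 2√2√(J∥J⊥)` (`2√(J∥J⊥)`) in CCO
(NBCO)», with the nearest-neighbour fits `J∥ (J⊥) = 158 meV (4.3 meV)` for CaCuO₂ and `123 meV (6.2 meV)`
for NdBa₂Cu₃O₇ [PengEtAl2017, p. 4].  Not here: which sign of `c` is called «acoustic»/«optical» in a
given stacking, anisotropy gaps, inter-bilayer terms. -/

/-- Radicand `(4J + zJ⊥)² − (4Jγ(h,k) + zJ⊥c)²` of the two-sublattice LSWT energy for a square-lattice
layer with `z` antiparallel interlayer neighbours per spin and interlayer phase `c`.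
[cite: Boothroyd2020, eq. (8.91)] -/
def stackRad (J Jp z c h k : ℝ) : ℝ :=
  (4 * J + z * Jp) ^ 2 - (4 * J * bilayerGamma h k + z * Jp * c) ^ 2

/-- `ħω = (Z_c/2)√((4J + zJ⊥)² − (4Jγ + zJ⊥c)²)` (`S = ½`; `Z_c` free as in this file).
[cite: Boothroyd2020, eq. (8.91)] -/
def stackOmega (Zc J Jp z c h k : ℝ) : ℝ := Zc / 2 * sqrt (stackRad J Jp z c h k)

/-- The stack gap `2Z_c√(zJJ⊥)`: «`E(0,0,½) ≃ 2√2√(J∥J⊥)`» for the infinite-layer stack (`z = 2`),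
«`2√(J∥J⊥)`» for the bilayer (`z = 1`). [cite: PengEtAl2017, p. 4] -/
def stackGap (Zc z J Jp : ℝ) : ℝ := 2 * Zc * sqrt (z * J * Jp)

/-- The stack gap inverted for `J⊥` at given `J`, `z`: `J⊥ = ω_g²/(4Z_c²zJ)`. [cite: PengEtAl2017, p. 4] -/
def stackJperpOfGap (Zc z J g : ℝ) : ℝ := g ^ 2 / (4 * Zc ^ 2 * z * J)

/-- Unfolding. [cite: Boothroyd2020, eq. (8.91)] -/
theorem stackRad_def (J Jp z c h k : ℝ) : stackRad J Jp z c h k =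
    (4 * J + z * Jp) ^ 2 - (4 * J * bilayerGamma h k + z * Jp * c) ^ 2 := rfl

/-- Unfolding. [cite: Boothroyd2020, eq. (8.91)] -/
theorem stackOmega_def (Zc J Jp z c h k : ℝ) :
    stackOmega Zc J Jp z c h k = Zc / 2 * sqrt (stackRad J Jp z c h k) := rfl

/-- Unfolding. [cite: PengEtAl2017, p. 4] -/
theorem stackGap_def (Zc z J Jp : ℝ) : stackGap Zc z J Jp = 2 * Zc * sqrt (z * J * Jp) := rfl

/-- Unfolding. [cite: PengEtAl2017, p. 4] -/
theorem stackJperpOfGap_def (Zc z J g : ℝ) :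
    stackJperpOfGap Zc z J g = g ^ 2 / (4 * Zc ^ 2 * z * J) := rfl

/-- **`z = 1`, `c = +1` is Hayden's OPTICAL radicand** times `16J²` (`J ≠ 0`):
`(4J + J⊥)² − (4Jγ + J⊥)² = 16J²[1 − γ² + (J⊥/2J)(1 − γ)]`. [cite: HaydenEtAl1996, p. 4] -/
theorem stackRad_one_pos {J : ℝ} (Jp h k : ℝ) (hJ : J ≠ 0) :
    stackRad J Jp 1 1 h k = 16 * J ^ 2 * bilayerRadOp J Jp h k := by
  rw [stackRad, bilayerRadOp]
  field_simp
  ring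

/-- **`z = 1`, `c = −1` is Hayden's ACOUSTIC radicand** times `16J²` (`J ≠ 0`). [cite: HaydenEtAl1996, p. 4] -/
theorem stackRad_one_neg {J : ℝ} (Jp h k : ℝ) (hJ : J ≠ 0) :
    stackRad J Jp 1 (-1) h k = 16 * J ^ 2 * bilayerRadAc J Jp h k := by
  rw [stackRad, bilayerRadAc]
  field_simp
  ring

/-- So the two-sublattice formula at `z = 1`, `c = +1` IS the printed optical branch (`J > 0`).
[cite: HaydenEtAl1996, p. 4] -/
theorem stackOmega_one_pos {J : ℝ} (Zc Jp h k : ℝ) (hJ : 0 < J) :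
    stackOmega Zc J Jp 1 1 h k = bilayerOmegaOp Zc J Jp h k := by
  rw [stackOmega, stackRad_one_pos Jp h k hJ.ne', bilayerOmegaOp,
    sqrt_mul (by positivity : (0 : ℝ) ≤ 16 * J ^ 2), sqrt_mul (by norm_num : (0 : ℝ) ≤ 16),
    sqrt_sq hJ.le, show sqrt (16 : ℝ) = 4 by
      rw [show (16 : ℝ) = 4 ^ 2 by norm_num, sqrt_sq (by norm_num : (0 : ℝ) ≤ 4)]]
  ring

/-- … and at `z = 1`, `c = −1` it IS the printed acoustic branch (`J > 0`). [cite: HaydenEtAl1996, p. 4] -/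
theorem stackOmega_one_neg {J : ℝ} (Zc Jp h k : ℝ) (hJ : 0 < J) :
    stackOmega Zc J Jp 1 (-1) h k = bilayerOmegaAc Zc J Jp h k := by
  rw [stackOmega, stackRad_one_neg Jp h k hJ.ne', bilayerOmegaAc,
    sqrt_mul (by positivity : (0 : ℝ) ≤ 16 * J ^ 2), sqrt_mul (by norm_num : (0 : ℝ) ≤ 16),
    sqrt_sq hJ.le, show sqrt (16 : ℝ) = 4 by
      rw [show (16 : ℝ) = 4 ^ 2 by norm_num, sqrt_sq (by norm_num : (0 : ℝ) ≤ 4)]]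
  ring

/-- In-plane phase `+1` (`(h,k) = (0,0)`), interlayer phase `−1`: radicand `16zJJ⊥`, for every `z`.
[cite: PengEtAl2017, p. 4] -/
theorem stackRad_zero_zero_neg (J Jp z : ℝ) : stackRad J Jp z (-1) 0 0 = 16 * (z * J * Jp) := by
  rw [stackRad, bilayerGamma_zero_zero]; ring

/-- In-plane phase `−1` (`(½,½)`), interlayer phase `+1`: the same radicand `16zJJ⊥`.
[cite: PengEtAl2017, p. 4] -/
theorem stackRad_half_half_pos (J Jp z : ℝ) :
    stackRad J Jp z 1 (1 / 2) (1 / 2) = 16 * (z * J * Jp) := by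
  rw [stackRad, bilayerGamma_half_half]; ring

/-- In-plane phase `−1`, interlayer phase `−1` (the antiferromagnetic zone centre of the stack):
Goldstone zero, for every `z`. [cite: Boothroyd2020, eq. (8.91)] -/
theorem stackRad_half_half_neg (J Jp z : ℝ) : stackRad J Jp z (-1) (1 / 2) (1 / 2) = 0 := by
  rw [stackRad, bilayerGamma_half_half]; ring

/-- `√(16x) = 4√x` (helper). [folklore] -/
private lemma sqrt_sixteen_mul (x : ℝ) : sqrt (16 * x) = 4 * sqrt x := by
  rw [sqrt_mul (by norm_num : (0 : ℝ) ≤ 16),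
    show sqrt (16 : ℝ) = 4 by rw [show (16 : ℝ) = 4 ^ 2 by norm_num, sqrt_sq (by norm_num : (0 : ℝ) ≤ 4)]]

/-- **The stack gap**: at `(0, 0)` with interlayer phase `−1` the energy is `2Z_c√(zJJ⊥)` — no sign
hypotheses. [cite: PengEtAl2017, p. 4] -/
theorem stackOmega_zero_zero_neg (Zc J Jp z : ℝ) :
    stackOmega Zc J Jp z (-1) 0 0 = stackGap Zc z J Jp := by
  rw [stackOmega, stackRad_zero_zero_neg, sqrt_sixteen_mul, stackGap]; ring

/-- … and the same energy at `(½, ½)` with interlayer phase `+1`. [cite: PengEtAl2017, p. 4] -/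
theorem stackOmega_half_half_pos (Zc J Jp z : ℝ) :
    stackOmega Zc J Jp z 1 (1 / 2) (1 / 2) = stackGap Zc z J Jp := by
  rw [stackOmega, stackRad_half_half_pos, sqrt_sixteen_mul, stackGap]; ring

/-- Goldstone zero of the stack at `(½, ½)`, interlayer phase `−1`. [cite: Boothroyd2020, eq. (8.91)] -/
theorem stackOmega_half_half_neg (Zc J Jp z : ℝ) : stackOmega Zc J Jp z (-1) (1 / 2) (1 / 2) = 0 := by
  rw [stackOmega, stackRad_half_half_neg, sqrt_zero, mul_zero]

/-- `z = 1`: the stack gap IS the bilayer optical gap `2Z_c√(JJ⊥)`. [cite: HaydenEtAl1996, p. 4] -/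
theorem stackGap_one (Zc J Jp : ℝ) : stackGap Zc 1 J Jp = bilayerGap Zc J Jp := by
  rw [stackGap, bilayerGap, one_mul]

/-- `z = 2`: the infinite-layer gap is `√2` times the bilayer gap at equal couplings —
«`2√2√(J∥J⊥)`» vs «`2√(J∥J⊥)`». [cite: PengEtAl2017, p. 4] -/
theorem stackGap_two (Zc J Jp : ℝ) : stackGap Zc 2 J Jp = sqrt 2 * bilayerGap Zc J Jp := by
  rw [stackGap, bilayerGap, mul_assoc (2 : ℝ) J Jp, sqrt_mul (by norm_num : (0 : ℝ) ≤ 2)]; ring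

/-- `ω_g² = 4Z_c²zJJ⊥` (`zJJ⊥ ≥ 0`). [cite: PengEtAl2017, p. 4] -/
theorem stackGap_sq {z J Jp : ℝ} (Zc : ℝ) (h : 0 ≤ z * J * Jp) :
    stackGap Zc z J Jp ^ 2 = 4 * Zc ^ 2 * (z * J * Jp) := by
  rw [stackGap, mul_pow, mul_pow, sq_sqrt h]; ring

/-- `ω_g ≥ 0` for `Z_c ≥ 0`. [cite: PengEtAl2017, p. 4] -/
theorem stackGap_nonneg {Zc : ℝ} (z J Jp : ℝ) (hZ : 0 ≤ Zc) : 0 ≤ stackGap Zc z J Jp := by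
  rw [stackGap]; positivity

/-- The stack inversion is the bilayer inversion divided by `z`: `ω_g²/(4Z_c²zJ) = [ω_g²/(4Z_c²J)]/z`.
[cite: PengEtAl2017, p. 4] -/
theorem stackJperpOfGap_eq_bilayer_div (Zc z J g : ℝ) :
    stackJperpOfGap Zc z J g = bilayerJperpOfGap Zc J g / z := by
  rw [stackJperpOfGap, bilayerJperpOfGap, div_div]; ring_nf

/-- In particular reading an INFINITE-LAYER gap with the BILAYER formula doubles `J⊥`:
`J⊥(z = 2) = ½ · ω_g²/(4Z_c²J)`. [cite: PengEtAl2017, p. 4] -/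
theorem stackJperpOfGap_two (Zc J g : ℝ) :
    stackJperpOfGap Zc 2 J g = bilayerJperpOfGap Zc J g / 2 := stackJperpOfGap_eq_bilayer_div Zc 2 J g

/-- Round trip 1 (`Z_c ≠ 0`, `z > 0`, `J > 0`, `J⊥ ≥ 0`). [cite: PengEtAl2017, p. 4] -/
theorem stackJperpOfGap_gap {Zc z J Jp : ℝ} (hZ : Zc ≠ 0) (hz : 0 < z) (hJ : 0 < J) (hJp : 0 ≤ Jp) :
    stackJperpOfGap Zc z J (stackGap Zc z J Jp) = Jp := by
  rw [stackJperpOfGap, stackGap_sq Zc (mul_nonneg (mul_nonneg hz.le hJ.le) hJp)]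
  field_simp

/-- Round trip 2 (`Z_c > 0`, `z > 0`, `J > 0`, `ω_g ≥ 0`). [cite: PengEtAl2017, p. 4] -/
theorem stackGap_jperpOfGap {Zc z J g : ℝ} (hZ : 0 < Zc) (hz : 0 < z) (hJ : 0 < J) (hg : 0 ≤ g) :
    stackGap Zc z J (stackJperpOfGap Zc z J g) = g := by
  rw [stackGap, stackJperpOfGap]
  have : z * J * (g ^ 2 / (4 * Zc ^ 2 * z * J)) = (g / (2 * Zc)) ^ 2 := by
    field_simp
    ring
  rw [this, sqrt_sq (div_nonneg hg (by linarith))]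
  field_simp

/-- The printed infinite-layer numbers (CaCuO₂, meV): `(2√2·√(158 · 4.3))² = 5435.2`, i.e.
`E(0,0,½) = √5435.2 ∈ (73.7, 73.8)`. [cite: PengEtAl2017, p. 4] -/
theorem peng2017_cco_gap : stackGap 1 2 158 4.3 ^ 2 = 5435.2 ∧
    (73.7 : ℝ) < stackGap 1 2 158 4.3 ∧ stackGap 1 2 158 4.3 < 73.8 := by
  have hsq : stackGap 1 2 158 4.3 ^ 2 = 5435.2 := by
    rw [stackGap_sq 1 (by norm_num)]; norm_num
  have hnn : 0 ≤ stackGap 1 2 158 4.3 := stackGap_nonneg 2 158 4.3 zero_le_one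
  refine ⟨hsq, ?_, ?_⟩
  · nlinarith
  · nlinarith

/-- The printed bilayer numbers (NdBa₂Cu₃O₇, meV): `(2√(123 · 6.2))² = 3050.4`, i.e.
`E = √3050.4 ∈ (55.2, 55.3)`. [cite: PengEtAl2017, p. 4] -/
theorem peng2017_nbco_gap : stackGap 1 1 123 6.2 ^ 2 = 3050.4 ∧
    (55.2 : ℝ) < stackGap 1 1 123 6.2 ∧ stackGap 1 1 123 6.2 < 55.3 := by
  have hsq : stackGap 1 1 123 6.2 ^ 2 = 3050.4 := by
    rw [stackGap_sq 1 (by norm_num)]; norm_num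
  have hnn : 0 ≤ stackGap 1 1 123 6.2 := stackGap_nonneg 1 123 6.2 zero_le_one
  refine ⟨hsq, ?_, ?_⟩
  · nlinarith
  · nlinarith

/-- The factor-two lesson as numbers: the CaCuO₂ gap `√5435.2` read with the infinite-layer formula at
`J = 158` returns `J⊥ = 4.3`; read with the BILAYER formula it would return `8.6`.
[cite: PengEtAl2017, p. 4] -/
theorem peng2017_cco_jperp_readings :
    stackJperpOfGap 1 2 158 (stackGap 1 2 158 4.3) = 4.3 ∧
    bilayerJperpOfGap 1 158 (stackGap 1 2 158 4.3) = 8.6 := by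
  refine ⟨stackJperpOfGap_gap one_ne_zero (by norm_num) (by norm_num) (by norm_num), ?_⟩
  rw [bilayerJperpOfGap, (peng2017_cco_gap).1]; norm_num

/-! ## 11. The printed numbers for PrBa₂Cu₃O₆₊ₓ (`Z_c = 1`, meV): the same producer on the Pr bilayer -/

/-- Boothroyd et al.'s PrBa₂Cu₃O₆.₂ fit is self-consistent with the measured optic gap:
`(2√(127·5.5))² = 2794`, i.e. `ω_g = √2794 ∈ (52.8, 52.9)` vs the printed `53 ± 2` (x ≈ 0.2) and
`54 ± 1` meV (x ≈ 0.93). [cite: BoothroydEtAl2005PrBCOSpinWaves, p. 5] -/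
theorem boothroyd2005_gap : bilayerGap 1 127 5.5 ^ 2 = 2794 ∧
    (52.8 : ℝ) < bilayerGap 1 127 5.5 ∧ bilayerGap 1 127 5.5 < 52.9 := by
  have hsq : bilayerGap 1 127 5.5 ^ 2 = 2794 := by
    rw [bilayerGap_sq 1 (by norm_num)]; norm_num
  have hnn : 0 ≤ bilayerGap 1 127 5.5 := bilayerGap_nonneg 127 5.5 zero_le_one
  refine ⟨hsq, ?_, ?_⟩
  · nlinarith
  · nlinarith

/-- The inverse map at the central values: `53²/(4·127) = 2809/508 ∈ (5.529, 5.530)` (x ≈ 0.2) and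
`54²/(4·127) = 2916/508 ∈ (5.740, 5.741)` (x ≈ 0.93) — both inside the printed `5.5 ± 0.9`; the
inter-planar exchange read off the two gaps differs by `107/508 ∈ (0.21, 0.211)` meV, inside the bar
(«do not vary with oxygen doping»). [cite: BoothroydEtAl2005PrBCOSpinWaves, p. 5] -/
theorem boothroyd2005_jperp_central :
    bilayerJperpOfGap 1 127 53 = 2809 / 508 ∧ bilayerJperpOfGap 1 127 54 = 2916 / 508 ∧
      (5.529 : ℝ) < 2809 / 508 ∧ (2809 : ℝ) / 508 < 5.530 ∧
      (5.740 : ℝ) < 2916 / 508 ∧ (2916 : ℝ) / 508 < 5.741 ∧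
      (2916 : ℝ) / 508 - 2809 / 508 = 107 / 508 ∧ (0.21 : ℝ) < 107 / 508 ∧ (107 : ℝ) / 508 < 0.211 := by
  refine ⟨?_, ?_, ?_, ?_, ?_, ?_, ?_, ?_, ?_⟩
  · rw [bilayerJperpOfGap]; norm_num
  · rw [bilayerJperpOfGap]; norm_num
  all_goals norm_num

/-- **The printed `J⊥ = 5.5 ± 0.9` is the box image of `ω_g = 53 ± 2`, `J∥ = 127 ± 10`**: every
`(ω_g, J∥)` in `[51, 55] × [117, 137]` gives `J⊥ ∈ [51²/(4·137), 55²/(4·117)] = [2601/548, 3025/468]`.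
[cite: BoothroydEtAl2005PrBCOSpinWaves, p. 5] -/
theorem boothroyd2005_jperp_box {g J : ℝ} (hg : g ∈ Set.Icc (51 : ℝ) 55)
    (hJ : J ∈ Set.Icc (117 : ℝ) 137) :
    (2601 : ℝ) / 548 ≤ bilayerJperpOfGap 1 J g ∧ bilayerJperpOfGap 1 J g ≤ 3025 / 468 := by
  obtain ⟨hglo, hghi⟩ := hg
  obtain ⟨hJlo, hJhi⟩ := hJ
  obtain ⟨h1, h2⟩ := bilayerJperpOfGap_box (Zc := 1) one_ne_zero (by norm_num : (0 : ℝ) < 117) hJlo hJhi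
    (by norm_num : (0 : ℝ) ≤ 51) hglo hghi
  refine ⟨le_trans (le_of_eq ?_) h1, le_trans h2 (le_of_eq ?_)⟩
  · rw [bilayerJperpOfGap]; norm_num
  · rw [bilayerJperpOfGap]; norm_num

/-- … and that box is `⊂ (4.74, 6.47)` meV — the printed `5.5 ± 0.9` = `[4.6, 6.4]` to the stated
precision. [cite: BoothroydEtAl2005PrBCOSpinWaves, p. 5] -/
theorem boothroyd2005_jperp_box_decimal : (4.74 : ℝ) < 2601 / 548 ∧ (3025 : ℝ) / 468 < 6.47 := by
  constructor <;> norm_num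

/-- Y → Pr halves the inter-planar exchange at unchanged `J∥` — convention-free ratios: `J⊥/J∥ =
5.5/127 ∈ (0.0433, 0.0434)` for PrBCO vs `11/125 = 0.088` for YBCO (`hayden1996_ratio`);
`J⊥(Pr)/J⊥(Y) = 5.5/11 = 0.5` at Hayden's value, and inside `(0.423, 0.612)` over the printed
YBCO₆.₁₅₋₆.₂ members «9 − 10 meV (Reznik) … 11 ± 2 meV (Hayden) … 13 ± 2 meV (own crystal)».
[cite: BoothroydEtAl2005PrBCOSpinWaves, p. 5] -/
theorem boothroyd2005_ratios :
    (0.0433 : ℝ) < 5.5 / 127 ∧ (5.5 : ℝ) / 127 < 0.0434 ∧ (5.5 : ℝ) / 11 = 0.5 ∧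
      (0.423 : ℝ) < 5.5 / 13 ∧ (5.5 : ℝ) / 9 < 0.612 := by
  refine ⟨?_, ?_, ?_, ?_, ?_⟩ <;> norm_num

/-- At equal `J∥` (and `Z_c`) the ratio of squared optic gaps IS the ratio of inter-planar exchanges:
`ω_g(J∥, J⊥)²/ω_g(J∥, J⊥′)² = J⊥/J⊥′` (`J∥ > 0`, `J⊥ ≥ 0`, `J⊥′ > 0`). [cite: ListerEtAl2001PrBCO, p. 3] -/
theorem bilayerGap_sq_ratio {J Jp Jp' : ℝ} (Zc : ℝ) (hZ : Zc ≠ 0) (hJ : 0 < J) (hJp : 0 ≤ Jp)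
    (hJp' : 0 < Jp') :
    bilayerGap Zc J Jp ^ 2 / bilayerGap Zc J Jp' ^ 2 = Jp / Jp' := by
  rw [bilayerGap_sq Zc (mul_nonneg hJ.le hJp), bilayerGap_sq Zc (mul_nonneg hJ.le hJp'.le)]
  have hJ' : J ≠ 0 := ne_of_gt hJ
  have hJp'' : Jp' ≠ 0 := ne_of_gt hJp'
  field_simp

/-- Same-criterion optic gaps («taken from the mid-point of the step»): `53 ± 2` meV (PrBCO₆.₂) vs
`70 ± 5` meV (YBCO₆.₂, «estimated in the same way»), so at equal `J∥` the `J⊥` ratio is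
`(53/70)² = 2809/4900 ∈ (0.573, 0.574)`. [cite: ListerEtAl2001PrBCO, p. 2] -/
theorem lister2001_gapRatio : ((53 : ℝ) / 70) ^ 2 = 2809 / 4900 ∧
    (0.573 : ℝ) < 2809 / 4900 ∧ (2809 : ℝ) / 4900 < 0.574 := by
  refine ⟨?_, ?_, ?_⟩ <;> norm_num

/-- Leading-order hopping ratio (§9 dictionary, `J⊥/J∥ = (t⊥/t)²`): `|t⊥/t| = √(5.5/127) ∈ (0.208, 0.209)`
for PrBCO vs `√(11/125) ∈ (0.296, 0.297)` for YBCO (`hayden1996_hoppingRatio`); over the error-bar box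
`J⊥ ∈ [4.6, 6.4]`, `J∥ ∈ [117, 137]` the extreme ratios give `√(4.6/137) > 0.183` and `√(6.4/117) < 0.234`
(a DERIVED one-band member, labelled so wherever used). [cite: BoothroydEtAl2005PrBCOSpinWaves, p. 5] -/
theorem boothroyd2005_hoppingRatio :
    (0.208 : ℝ) < sqrt (5.5 / 127) ∧ sqrt ((5.5 : ℝ) / 127) < 0.209 ∧
      (0.183 : ℝ) < sqrt (4.6 / 137) ∧ sqrt ((6.4 : ℝ) / 117) < 0.234 := by
  refine ⟨?_, ?_, ?_, ?_⟩
  · rw [lt_sqrt (by norm_num)]; norm_num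
  · rw [sqrt_lt' (by norm_num)]; norm_num
  · rw [lt_sqrt (by norm_num)]; norm_num
  · rw [sqrt_lt' (by norm_num)]; norm_num

/-- Zone-boundary (single-magnon maximum) energy at the PrBCO values, `Z_c = 1`:
`ω(½, 0) = 254√(1 + 5.5/254) = √65913 ∈ (256.7, 256.8)` meV — above the measured window (data «too low
to obtain statistically meaningful data above 150 meV»; «∼ 260 meV … the anticipated maximum in the
one-magnon spectrum»). [cite: BoothroydEtAl2005PrBCOSpinWaves, p. 2] -/
theorem boothroyd2005_zoneBoundary :
    bilayerOmegaAc 1 127 5.5 (1 / 2) 0 ^ 2 = 65913 ∧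
      (256.7 : ℝ) < bilayerOmegaAc 1 127 5.5 (1 / 2) 0 ∧ bilayerOmegaAc 1 127 5.5 (1 / 2) 0 < 256.8 := by
  have hval : bilayerOmegaAc 1 127 5.5 (1 / 2) 0 = sqrt 65913 := by
    rw [(bilayerOmega_half_zero 1 127 5.5).1,
      bilayerOmega_zoneBoundary_closed 1 5.5 (by norm_num : (0 : ℝ) < 127)]
    norm_num
  have hnn : (0 : ℝ) ≤ 65913 := by norm_num
  rw [hval, sq_sqrt hnn]
  refine ⟨rfl, ?_, ?_⟩
  · rw [lt_sqrt (by norm_num)]; norm_num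
  · rw [sqrt_lt' (by norm_num)]; norm_num

end

end Literature.MathematicalPhysics.QuantumLattice
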